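import Summits.CriticalPhenomena.CardyFormulaZ2.Theorems.ModulusResponseSegmentTransportStubExactFromApproximate
import Summits.CriticalPhenomena.CardyFormulaZ2.Theorems.ModulusResponseSegmentTransportStubRelativeConfinement
import HarnessLib

/-!
# Approximate linear-image Cardy for every tolerance ⇒ exact linear-image Cardy
# (line `birth`, crux `SegmentTransport`, stmt-CriticalPhenomena-11199 — the line's bootstrap, packaged)

Route `ModulusResponse` of `CriticalPhenomena/CardyFormulaZ2`. For an ARBITRARY set function
`P : Set ℂ → ℝ → Set ℂ → Set ℂ → ℝ` (`(Ω, δ, A, B) ↦` "crossing probability of `Ω` at mesh `δ` between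
the arcs `A`, `B`") and the pinned diagonal stretches `S_t z = cosh t · z + i sinh t · z̄`: if for every
`ε > 0` SOME stretch `t_ε` makes `P` `ε`-approximately linear-image Cardy for every conformal rectangle
and every uniformizing datum (eventually as `δ → 0⁺`), then ONE stretch makes it exactly linear-image
Cardy (`HasCrossingLimit`) for every conformal rectangle. No bound on the `t_ε` is assumed: by
`stub_relativeConfinement` all `t_ε`, `ε ≤ 1/8`, lie within a universal distance `T` of the reference
stretch `t_{1/8}`, and `stub_exactFromApproximate` (Bolzano–Weierstrass + Radó) concludes. This is
exactly the tail of the skeleton's `SegmentTransport_of` (Cruxes/SegmentTransport/Lines/birth.lean),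
stated once as a reusable theorem: any proof of "for every `u` and every `ε` some stretch is
`ε`-approximately Cardy for `μ_u`" closes the crux through it.
-/

noncomputable section

open Set Filter
open Literature.Probability.RandomPlanarGeometry

namespace Summit.CriticalPhenomena.CardyFormulaZ2.Cruxes.SegmentTransport.Birth

/-- **Approximate linear-image Cardy for every tolerance implies exact linear-image Cardy** (any set
function `P`, pinned stretches `S`; no a-priori bound on the approximating stretches): a reference
stretch `t₁` at tolerance `1/8` and `stub_relativeConfinement` confine every `t_ε` (`ε ≤ 1/8`) to
`[-(|t₁| + T), |t₁| + T]`, and `stub_exactFromApproximate` upgrades to an exact crossing limit. -/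
theorem exact_of_forall_approx :
    ∀ (P : Set ℂ → ℝ → Set ℂ → Set ℂ → ℝ) (S : ℝ → ℂ → ℂ), (∀ t z, S t z = (Real.cosh t : ℂ) * z + Complex.I * (Real.sinh t : ℂ) * (starRingEnd ℂ) z) → (∀ ε : ℝ, 0 < ε → ∃ t : ℝ, ∀ (R : Literature.Probability.RandomPlanarGeometry.ConformalRectangle) (φ : Literature.Probability.RandomPlanarGeometry.ConformalEquiv UpperHalfPlane.upperHalfPlaneSet R.carrier) (x : Fin 4 → ℝ), R.IsUniformizing φ x → ∀ᶠ δ in nhdsWithin (0 : ℝ) (Set.Ioi 0), |P (S t '' R.carrier) δ (S t '' R.arc 0) (S t '' R.arc 2) - Literature.Probability.RandomPlanarGeometry.cardyFunction (Literature.Probability.RandomPlanarGeometry.crossRatio x)| ≤ ε) → ∃ t : ℝ, ∀ R : Literature.Probability.RandomPlanarGeometry.ConformalRectangle, R.HasCrossingLimit (fun δ ↦ P (S t '' R.carrier) δ (S t '' R.arc 0) (S t '' R.arc 2)) Literature.Probability.RandomPlanarGeometry.cardyFunction := by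
  intro P S hS happrox
  obtain ⟨T₀, hT₀⟩ := stub_relativeConfinement
  obtain ⟨t₁, ht₁⟩ := happrox (1 / 8) (by norm_num)
  refine stub_exactFromApproximate P S hS (|t₁| + T₀) ?_
  intro ε hε
  obtain ⟨t, ht⟩ := happrox (min ε (1 / 8)) (lt_min hε (by norm_num))
  have hdist : |t - t₁| ≤ T₀ :=
    hT₀ P S hS t t₁ (fun R φ x hux ↦ (ht R φ x hux).mono fun δ hδ ↦ hδ.trans (min_le_right _ _)) ht₁
  refine ⟨t, ⟨?_, ?_⟩, fun R φ x hux ↦ (ht R φ x hux).mono fun δ hδ ↦ hδ.trans (min_le_left _ _)⟩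
  · linarith [(abs_le.1 hdist).1, neg_abs_le t₁]
  · linarith [(abs_le.1 hdist).2, le_abs_self t₁]

end Summit.CriticalPhenomena.CardyFormulaZ2.Cruxes.SegmentTransport.Birth

end
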